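import Literature.MathematicalPhysics.QuantumFieldTheory.Balaban1983to89.B11Eq118RegimeRadiiUniform

/-!
# `Balaban1983to89.B11Eq118RegimeScalars` — T. Bałaban, *The variational problem and background fields in renormalization group method for
# lattice gauge theories*, Commun. Math. Phys. **102** (1985) 277–309 [Balaban1985Variational] Prop. 6 (117)–(121) p. 295 and Sect. C (62)
# p. 287: THE SCALAR LETTERS OF THE TWO CONTRACTION REGIMES CHOSEN FROM BOUNDS ONLY — «for ε₁ sufficiently small» made explicit AND UNIFORM:
# the radii `j, a, ε₄, a_C, ε_C, R′, R_b` depend only on upper BOUNDS `B₀ ≥ ‖𝒢‖`, `b ≥ ‖H‖`, `b₁ ≥ ‖H₁‖` and the quadratic-analyticity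
# constants, hence ONE choice serves every triple `(𝒢, H, H₁)` under the bounds (e.g. a whole family of backgrounds)

statement-level skeleton of published theorems with citation tags; proofs where landed; nothing here is a claim
about the Yang–Mills mass gap

PDF held: `paper:balaban1985-cmp102-variational-background` (journal page = PDF page + 276), pp. 287, 289, 295 read through the verbatim quotations of
`B11Eq174Chart` / `B11Eq118RegimeRadii` (v2); v2.1 (gen 82, docstring-only re-filing; statements and proofs byte-identical): pp. 287, 289, 295 re-read
FIRST-HAND on the text layer (p0011/p0013/p0019, 2026-08-22) after the X-reader ne9-leaf-02 g57's render reads (C-ne9leaf02g57-1), whose three LOW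
corrections this header adopts.

THE PRINT.  Prop. 6 p. 295 (verbatim, L32–33): *«There exists a positive, absolute constant a₄ such, that for ε₄ ≤ a₄ and ε₁ satisfying
2B₀C₁B₃ε₁ ≤ ε₄ Eq. (111) has exactly one solution in the space (115)»*, with the printed conditions (118) `B₀C₁B₃ε₁ + B₀C₄(ε₄ + 2dLB₀C₁ε₁)² ≤ ε₄` and
(121) `2ε₄ + 4dLB₀C₁ε₁ ≤ a₃, 4B₀C₄(ε₄ + 2dLB₀C₁ε₁) ≤ ½` (right member per the render read of C-ne9leaf02g57-1; the text layer is garbled there); the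
forms used below — `2(ε₄ + a) ≤ a₃`, `4B₀C₄(ε₄ + a) < 1` with a datum radius `a` — are the SCHEME'S letters (`B11Eq174Chart.Regime.dom/contr`: `a` for
`2dLB₀C₁ε₁`, `< 1` a free weakening of `≤ ½`), not print's text.  Sect. C p. 287 L4–5 (verbatim): *«The transformation is defined for ε₃ satisfying
2ε₃ ≦ c₄ (see Proposition 4 in [4]) and ε₃ ≦ (18C₂B₀)⁻¹»*, L14–15: *«Thus for ε₂ ≦ ¼ε₃, there exists exactly one fixed point of (61)»*; (62) itself
(L17) is the `A′`-size display `L^jη|A′|, (L^jη)²|∇A′| < ε₂ + 16C₂B₀ε₂² < 2ε₂ ≦ ½ε₃`; Prop. 3 p. 289 gathers these («with ε₃ sufficiently small (e.g.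
18C₂B₀dc₁(…)ε₃ ≦ 1, 2ε₃ ≦ c₄). The range of this transformation contains the set (43) with ε₂ ≦ ¼ε₃»).  In print `B₀` is A BOUND («|G₁|, |𝔊| ≤ B₀», (117) p. 295 / [5] Thm 3.4), uniform in the lattice —
NOT the operator norm of one operator; the radii are functions of the bounds.  `B11Eq118RegimeRadii.exists_twoRegimes_radii` chose them at
`B₀ := ‖𝒢‖`, `b := ‖H‖` (one operator at a time); pub-balaban NE9 leaf-01's `B11Eq118RegimeRadiiUniform` (imported) gives the CLOSED-FORM
radius `regime_explicit` and the constructor `Regime.of_normBound_zeroLinear` at a bound, with the carriers fixed as section variables.  This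
file adds the two shapes a uniform statement over a family of backgrounds `U` consumes in one line: the seven scalar letters as PURE
ARITHMETIC (no operator, no carrier), and the corollary with the carriers `𝒴 𝒵 𝒳 ℬ` AND the operators quantified INSIDE the `∃` (the chart
spaces `Space115 … (∇_U)` are U-indexed TYPES, so radii chosen before `∀ U` must be quantified before the carriers).

WHAT IS PROVED (sorry-free; pure real arithmetic + leaf-01's constructor `Regime.of_normBound_zeroLinear`; no `Prop` placeholder; no inequality
of the paper asserted).
* `exists_regime_scalars` — `∃ j a ε₄ > 0` below a cap `δ` with (121)/(118) at a bound `B₀` (pure arithmetic; the ∃-form of leaf-01's closed form).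
* **`exists_twoRegimes_scalars`** — given numbers `B₀, b, b₁ ≥ 0`, `C₄ ≥ 0`, `a₃ > 0`, `C₂ ≥ 0`, `c₄ > 0`: `∃ j a ε₄ a_C ε_C R′ R_b > 0` with
  (121)/(118) at `(B₀, C₄, a₃)`: `2(ε₄ + a) ≤ a₃`, `B₀j + B₀C₄(ε₄ + a)² ≤ ε₄`, `4B₀C₄(ε₄ + a) < 1`; their Sect. C twins at `(b, C₂, c₄)` with `j = 0`:
  `2(ε_C + a_C) ≤ c₄`, `bC₂(ε_C + a_C)² ≤ ε_C`, `4bC₂(ε_C + a_C) < 1`; the compatibility `ε₄ + a ≤ a_C` ((62)); the datum-ball letter `b₁R_b < a`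
  ((172): `‖H₁B‖ ≤ b₁‖B‖ < a` on `‖B‖ < R_b`); and the chart radius `(ε₄ + a)/(1 − 4bC₂(ε_C + a_C)) ≤ R′`.
* v2.1 (gen 82, APPEND-ONLY + the header docfix): **`exists_twoRegimes_radii_of_bounds_room`** — the same radii chosen at `(3C₄, a₃/3)`, `(3C₂, c₄/3)`,
  giving in addition `6(ε₄ + a) ≤ a₃`, `12B₀C₄(ε₄ + a) < 1` and the Sect. C twins — the room for `B11Eq120SolutionContinuity`'s second contraction;
  v2.2 (gen 82, APPEND-ONLY): **`exists_twoRegimes_radii_of_bounds_room_cap`** — the same under a cap `ε_C + a_C ≤ δ` on the Sect. C ball.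
* **`exists_twoRegimes_radii_of_bounds`** — the corollary with the operators quantified AFTER the radii: ONE tuple of radii such that for ALL complex
  normed spaces and ALL `𝒢`, `W`, `H`, `C`, `H₁` with `‖𝒢f‖ ≤ B₀‖f‖`, `QuadAnalytic W C₄ a₃`, `‖HY‖ ≤ b‖Y‖`, `QuadAnalytic C C₂ c₄`, `‖H₁B‖ ≤ b₁‖B‖`:
  both `Regime`s hold, `ε₄ + a ≤ a_C`, `‖H₁B‖ < a` on `ball 0 R_b`, and the `R′` inequality — letter for letter the scalar hypotheses of the cell's
  `NE9B11ChartAnalytic.chartHB_triple_of_twoRegimes`.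
MODEL / HONEST SCOPE.  Abstract complex normed spaces and continuous linear maps, as in `B11Eq174Chart`; EXISTENCE of admissible radii from bounds
(the bounds themselves — print's uniform `B₀` via [5] Thm 3.4 / Thms 3.12–3.13 — are NOT derived here); NOT summit progress (cell pub-balaban: NE9 NOT
PRINTED / NOT PROVED; spine PROVED 0/9).  Filed by the pub-balaban NE9 BINDER-row owner lineage `b2b-balaban-t4-ne9-p1` (gen 81); NEW file importing
NE9 leaf-01's `B11Eq118RegimeRadiiUniform` only (hence `B11Eq118RegimeRadii`); nothing modified.  Net new unproved facts: 0.
-/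

noncomputable section

namespace Literature.MathematicalPhysics.QuantumFieldTheory.Balaban1983to89.B11Eq118RegimeScalars

open Metric Set
open Literature.MathematicalPhysics.QuantumFieldTheory.Balaban1983to89
open Literature.MathematicalPhysics.QuantumFieldTheory.Balaban1983to89.B13Contraction113 (QuadAnalytic)
open Literature.MathematicalPhysics.QuantumFieldTheory.Balaban1983to89.B11Eq174Chart (Regime)
open Literature.MathematicalPhysics.QuantumFieldTheory.Balaban1983to89.B11Eq118RegimeRadiiUniform (Regime.of_normBound_zeroLinear)

/-- **The radii of ONE regime from a bound `B₀ ≥ 0`**, below any cap `δ > 0`: `ε₄ := min(a₃/4, δ/2, 1/(16(B₀C₄ + 1)))`, `a := ε₄`,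
`j := ε₄/(4(B₀ + 1))` satisfy (121) and (118) in the form `B₀j + B₀C₄(ε₄ + a)² ≤ ε₄` — print's «for ε₁ sufficiently small», the smallness
depending on `B₀, C₄, a₃` only. [cite: Balaban1985Variational, Prop. 6 (118), (121) p.295] -/
theorem exists_regime_scalars {B₀ C₄ a₃ : ℝ} (hB₀ : 0 ≤ B₀) (hC₄ : 0 ≤ C₄) (ha₃ : 0 < a₃) {δ : ℝ} (hδ : 0 < δ) :
    ∃ j a ε₄ : ℝ, 0 < j ∧ 0 < a ∧ 0 < ε₄ ∧ ε₄ + a ≤ δ ∧ 2 * (ε₄ + a) ≤ a₃ ∧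
      B₀ * j + B₀ * C₄ * (ε₄ + a) ^ 2 ≤ ε₄ ∧ 4 * B₀ * C₄ * (ε₄ + a) < 1 := by
  set ε₄ : ℝ := min (a₃ / 4) (min (δ / 2) (1 / (16 * (B₀ * C₄ + 1)))) with hε₄def
  have hK : 0 < B₀ * C₄ + 1 := by positivity
  have hε₄0 : 0 < ε₄ := by
    rw [hε₄def]; exact lt_min (by positivity) (lt_min (by positivity) (by positivity))
  have hε₄a : ε₄ ≤ a₃ / 4 := min_le_left _ _
  have hε₄δ : ε₄ ≤ δ / 2 := (min_le_right _ _).trans (min_le_left _ _)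
  have hε₄K : ε₄ ≤ 1 / (16 * (B₀ * C₄ + 1)) := (min_le_right _ _).trans (min_le_right _ _)
  have hprod : 16 * (B₀ * C₄) * ε₄ ≤ 1 := by
    have h1 : 16 * (B₀ * C₄ + 1) * ε₄ ≤ 1 := by
      rw [le_div_iff₀ (by positivity)] at hε₄K; linarith
    nlinarith
  refine ⟨ε₄ / (4 * (B₀ + 1)), ε₄, ε₄, by positivity, hε₄0, hε₄0, by linarith, by linarith, ?_, ?_⟩
  · -- (118): `B₀ j + B₀C₄(2ε₄)² ≤ ε₄/4 + ε₄/4 ≤ ε₄`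
    have h1 : B₀ * (ε₄ / (4 * (B₀ + 1))) ≤ ε₄ / 4 := by
      rw [mul_div_assoc', div_le_div_iff₀ (by positivity) (by positivity)]
      nlinarith
    have h2 : B₀ * C₄ * (ε₄ + ε₄) ^ 2 ≤ ε₄ / 4 := by nlinarith
    linarith
  · -- (121) second member: `4B₀C₄·2ε₄ ≤ 1/2 < 1`
    nlinarith

/-- **THE SCALAR LETTERS OF THE COMPOSITE CHART (174)∘(47) FROM BOUNDS ONLY** — given bounds `B₀` (for `𝔊`), `b` (for `H`), `b₁` (for `H₁`) and the
quadratic-analyticity constants `(C₄, a₃)` of `W`, `(C₂, c₄)` of `C`: positive radii with the Sect. E/G conditions (118)/(121) at `B₀`, the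
Sect. C conditions at `b` (current letter `0`), the compatibility `ε₄ + a ≤ a_C` («ε₂ ≤ ¼ε₃», (62)), the datum-ball letter `b₁·R_b < a` ((172):
then `|H₁B| ≤ b₁|B| < a` for `|B| < R_b`) and the chart radius `(ε₄ + a)/(1 − 4bC₂(ε_C + a_C)) ≤ R′`.  PURE ARITHMETIC: no operator occurs.
[cite: Balaban1985Variational, Prop. 6 (117)–(121) p.295, (62) p.287, Prop. 3 p.289, (172) p.305] -/
theorem exists_twoRegimes_scalars {B₀ b b₁ C₄ a₃ C₂ c₄ : ℝ} (hB₀ : 0 ≤ B₀) (hb : 0 ≤ b) (hb₁ : 0 ≤ b₁) (hC₄ : 0 ≤ C₄) (ha₃ : 0 < a₃)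
    (hC₂ : 0 ≤ C₂) (hc₄ : 0 < c₄) :
    ∃ j a ε₄ aC εC R' Rb : ℝ, 0 < j ∧ 0 < a ∧ 0 < ε₄ ∧ 0 < aC ∧ 0 < εC ∧ 0 < R' ∧ 0 < Rb ∧
      (2 * (ε₄ + a) ≤ a₃ ∧ B₀ * j + B₀ * C₄ * (ε₄ + a) ^ 2 ≤ ε₄ ∧ 4 * B₀ * C₄ * (ε₄ + a) < 1) ∧
      (2 * (εC + aC) ≤ c₄ ∧ b * 0 + b * C₂ * (εC + aC) ^ 2 ≤ εC ∧ 4 * b * C₂ * (εC + aC) < 1) ∧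
      ε₄ + a ≤ aC ∧ b₁ * Rb < a ∧ 1 / (1 - 4 * b * C₂ * (εC + aC)) * (ε₄ + a) ≤ R' := by
  -- Sect. C radii first (cap 1), then Sect. E/G radii under the cap `a_C`
  obtain ⟨j₁, aC, εC, hj₁, haC, hεC, -, hCdom, hCself, hCcontr⟩ := exists_regime_scalars hb hC₂ hc₄ one_pos
  obtain ⟨j, a, ε₄, hj, ha, hε₄, hcap, hdom, hself, hcontr⟩ := exists_regime_scalars hB₀ hC₄ ha₃ haC
  have hden : 0 < 1 - 4 * b * C₂ * (εC + aC) := by linarith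
  refine ⟨j, a, ε₄, aC, εC, 1 / (1 - 4 * b * C₂ * (εC + aC)) * (ε₄ + a), a / (b₁ + 1), hj, ha, hε₄, haC, hεC, by positivity,
    by positivity, ⟨hdom, hself, hcontr⟩, ⟨hCdom, ?_, hCcontr⟩, hcap, ?_, le_rfl⟩
  · have h0 : 0 ≤ b * j₁ := mul_nonneg hb hj₁.le
    rw [mul_zero, zero_add]; linarith
  · rw [mul_div_assoc', div_lt_iff₀ (by positivity)]
    nlinarith

section TwoRegimes

/-- **ONE TUPLE OF RADII FOR EVERY TRIPLE `(𝒢, H, H₁)` UNDER THE BOUNDS** — the operators, their spaces and the maps `W`, `C` are quantified AFTER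
the radii: for all complex normed spaces `𝒴 𝒵 𝒳 ℬ` and all `𝒢 : 𝒵 →L 𝒴`, `W : 𝒴 → 𝒵`, `H : 𝒳 →L 𝒴`, `C : 𝒴 → 𝒳`, `H₁ : ℬ →L 𝒴` with
`‖𝒢f‖ ≤ B₀‖f‖`, `QuadAnalytic W C₄ a₃`, `‖HY‖ ≤ b‖Y‖`, `QuadAnalytic C C₂ c₄`, `‖H₁B‖ ≤ b₁‖B‖`: the Sect. E/G regime `Regime 𝒢 0 W B₀ 0 C₄ a₃ j a ε₄`,
the Sect. C regime `Regime H 0 C b 0 C₂ c₄ 0 a_C ε_C`, `ε₄ + a ≤ a_C`, `‖H₁B‖ < a` on `ball 0 R_b`, `(ε₄ + a)/(1 − 4bC₂(ε_C + a_C)) ≤ R′` — exactly the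
scalar hypotheses of the composite-chart theorem, now SHARED (print's (117): the radii are functions of the bounds `B₀`, not of the operator).
[cite: Balaban1985Variational, Prop. 6 (117)–(121) p.295, (62) p.287, Prop. 3 p.289, (172) p.305] -/
theorem exists_twoRegimes_radii_of_bounds {B₀ b b₁ C₄ a₃ C₂ c₄ : ℝ} (hB₀ : 0 ≤ B₀) (hb : 0 ≤ b) (hb₁ : 0 ≤ b₁) (hC₄ : 0 ≤ C₄)
    (ha₃ : 0 < a₃) (hC₂ : 0 ≤ C₂) (hc₄ : 0 < c₄) :
    ∃ j a ε₄ aC εC R' Rb : ℝ, 0 < j ∧ 0 < a ∧ 0 < ε₄ ∧ 0 < aC ∧ 0 < εC ∧ 0 < R' ∧ 0 < Rb ∧ ε₄ + a ≤ aC ∧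
      1 / (1 - 4 * b * C₂ * (εC + aC)) * (ε₄ + a) ≤ R' ∧
      ∀ {𝒴 : Type*} [NormedAddCommGroup 𝒴] [NormedSpace ℂ 𝒴] {𝒵 : Type*} [NormedAddCommGroup 𝒵] [NormedSpace ℂ 𝒵]
        {𝒳 : Type*} [NormedAddCommGroup 𝒳] [NormedSpace ℂ 𝒳] {ℬ : Type*} [NormedAddCommGroup ℬ] [NormedSpace ℂ ℬ]
        (𝒢 : 𝒵 →L[ℂ] 𝒴) (W : 𝒴 → 𝒵) (H : 𝒳 →L[ℂ] 𝒴) (C : 𝒴 → 𝒳) (H₁ : ℬ →L[ℂ] 𝒴),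
        (∀ f, ‖𝒢 f‖ ≤ B₀ * ‖f‖) → QuadAnalytic W C₄ a₃ → (∀ Y, ‖H Y‖ ≤ b * ‖Y‖) → QuadAnalytic C C₂ c₄ →
        (∀ B, ‖H₁ B‖ ≤ b₁ * ‖B‖) →
        Regime 𝒢 0 W B₀ 0 C₄ a₃ j a ε₄ ∧ Regime H 0 C b 0 C₂ c₄ 0 aC εC ∧ ∀ B ∈ ball (0 : ℬ) Rb, ‖H₁ B‖ < a := by
  obtain ⟨j, a, ε₄, aC, εC, R', Rb, hj, ha, hε₄, haC, hεC, hR', hRb, ⟨hdom, hself, hcontr⟩, ⟨hCdom, hCself, hCcontr⟩, hcap, hb₁Rb, hR'le⟩ :=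
    exists_twoRegimes_scalars hB₀ hb hb₁ hC₄ ha₃ hC₂ hc₄
  refine ⟨j, a, ε₄, aC, εC, R', Rb, hj, ha, hε₄, haC, hεC, hR', hRb, hcap, hR'le, ?_⟩
  intro 𝒴 _ _ 𝒵 _ _ 𝒳 _ _ ℬ _ _ 𝒢 W H C H₁ h𝒢 hW hH hC hH₁
  refine ⟨Regime.of_normBound_zeroLinear 𝒢 hB₀ h𝒢 hW hC₄ hε₄.le hdom hself hcontr,
    Regime.of_normBound_zeroLinear H hb hH hC hC₂ hεC.le hCdom hCself hCcontr, fun B hB => ?_⟩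
  rw [mem_ball_zero_iff] at hB
  have h1 := hH₁ B
  have h2 : b₁ * ‖B‖ ≤ b₁ * Rb := mul_le_mul_of_nonneg_left hB.le hb₁
  linarith

end TwoRegimes

/-! ## §4 (v2.1, gen 82, APPEND-ONLY) Radii WITH ROOM for the cross-carrier comparison of `B11Eq120SolutionContinuity` -/

section Room

/-- **THE SAME RADII WITH ROOM FOR A SECOND CONTRACTION ON A LARGER BALL** — the scalar letters chosen at `(3C₄, a₃∕3)` and `(3C₂, c₄∕3)` (a stronger
«ε₁ sufficiently small»): besides both regimes, the compatibility `ε₄ + a ≤ a_C`, the datum letter on `ball 0 R_b` and the chart radius `R′`, one gets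
`6(ε₄ + a) ≤ a₃`, `12B₀C₄(ε₄ + a) < 1`, `6(ε_C + a_C) ≤ c₄`, `12bC₂(ε_C + a_C) < 1` — the radius bookkeeping `ρ := 2(ε₄ + a)`, `s := ε₄ + a` (and the Sect. C
twin) of `B11Eq120SolutionContinuity.norm_map_chartHB_sectC_sub_le` for a comparison map of norm `≤ 2`.  PURE ARITHMETIC.
[cite: Balaban1985Variational, Prop. 6 (117)–(121) p.295, (62) p.287, Prop. 3 p.289, (172) p.305] -/
theorem exists_twoRegimes_radii_of_bounds_room {B₀ b b₁ C₄ a₃ C₂ c₄ : ℝ} (hB₀ : 0 ≤ B₀) (hb : 0 ≤ b) (hb₁ : 0 ≤ b₁) (hC₄ : 0 ≤ C₄)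
    (ha₃ : 0 < a₃) (hC₂ : 0 ≤ C₂) (hc₄ : 0 < c₄) :
    ∃ j a ε₄ aC εC R' Rb : ℝ, 0 < j ∧ 0 < a ∧ 0 < ε₄ ∧ 0 < aC ∧ 0 < εC ∧ 0 < R' ∧ 0 < Rb ∧ ε₄ + a ≤ aC ∧
      1 / (1 - 4 * b * C₂ * (εC + aC)) * (ε₄ + a) ≤ R' ∧
      (6 * (ε₄ + a) ≤ a₃ ∧ 12 * B₀ * C₄ * (ε₄ + a) < 1 ∧ 6 * (εC + aC) ≤ c₄ ∧ 12 * b * C₂ * (εC + aC) < 1) ∧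
      ∀ {𝒴 : Type*} [NormedAddCommGroup 𝒴] [NormedSpace ℂ 𝒴] {𝒵 : Type*} [NormedAddCommGroup 𝒵] [NormedSpace ℂ 𝒵]
        {𝒳 : Type*} [NormedAddCommGroup 𝒳] [NormedSpace ℂ 𝒳] {ℬ : Type*} [NormedAddCommGroup ℬ] [NormedSpace ℂ ℬ]
        (𝒢 : 𝒵 →L[ℂ] 𝒴) (W : 𝒴 → 𝒵) (H : 𝒳 →L[ℂ] 𝒴) (C : 𝒴 → 𝒳) (H₁ : ℬ →L[ℂ] 𝒴),
        (∀ f, ‖𝒢 f‖ ≤ B₀ * ‖f‖) → QuadAnalytic W C₄ a₃ → (∀ Y, ‖H Y‖ ≤ b * ‖Y‖) → QuadAnalytic C C₂ c₄ →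
        (∀ B, ‖H₁ B‖ ≤ b₁ * ‖B‖) →
        Regime 𝒢 0 W B₀ 0 C₄ a₃ j a ε₄ ∧ Regime H 0 C b 0 C₂ c₄ 0 aC εC ∧ ∀ B ∈ ball (0 : ℬ) Rb, ‖H₁ B‖ < a := by
  have hC₄3 : 0 ≤ 3 * C₄ := by positivity
  have hC₂3 : 0 ≤ 3 * C₂ := by positivity
  obtain ⟨j, a, ε₄, aC, εC, R', Rb, hj, ha, hε₄, haC, hεC, hR', hRb, ⟨hdom, hself, hcontr⟩, ⟨hCdom, hCself, hCcontr⟩, hcap, hb₁Rb, hR'le⟩ :=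
    exists_twoRegimes_scalars hB₀ hb hb₁ hC₄3 (by positivity : 0 < a₃ / 3) hC₂3 (by positivity : 0 < c₄ / 3)
  -- the regime conditions at `(C₄, a₃)`, `(C₂, c₄)` follow from those at `(3C₄, a₃/3)`, `(3C₂, c₄/3)`
  have hm : 0 ≤ ε₄ + a := by linarith
  have hmC : 0 ≤ εC + aC := by linarith
  have hself' : B₀ * j + B₀ * C₄ * (ε₄ + a) ^ 2 ≤ ε₄ := by nlinarith [mul_nonneg hB₀ hC₄, sq_nonneg (ε₄ + a)]
  have hcontr' : 4 * B₀ * C₄ * (ε₄ + a) < 1 := by nlinarith [mul_nonneg (mul_nonneg hB₀ hC₄) hm]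
  have hCself' : b * 0 + b * C₂ * (εC + aC) ^ 2 ≤ εC := by nlinarith [mul_nonneg hb hC₂, sq_nonneg (εC + aC)]
  have hCcontr' : 4 * b * C₂ * (εC + aC) < 1 := by nlinarith [mul_nonneg (mul_nonneg hb hC₂) hmC]
  have hden' : 4 * b * C₂ * (εC + aC) ≤ 4 * b * (3 * C₂) * (εC + aC) := by nlinarith [mul_nonneg hb hC₂, hmC]
  have hden3 : 0 < 1 - 4 * b * (3 * C₂) * (εC + aC) := by linarith
  refine ⟨j, a, ε₄, aC, εC, R', Rb, hj, ha, hε₄, haC, hεC, hR', hRb, hcap, ?_, ⟨by linarith, by linarith, by linarith, by linarith⟩, ?_⟩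
  · -- `R′` was chosen at the larger denominator constant `3C₂`; the smaller one gives a smaller quotient
    refine le_trans ?_ hR'le
    refine mul_le_mul_of_nonneg_right ?_ hm
    exact one_div_le_one_div_of_le hden3 (by linarith)
  intro 𝒴 _ _ 𝒵 _ _ 𝒳 _ _ ℬ _ _ 𝒢 W H C H₁ h𝒢 hW hH hC hH₁
  refine ⟨Regime.of_normBound_zeroLinear 𝒢 hB₀ h𝒢 hW hC₄ hε₄.le (by linarith) hself' hcontr',
    Regime.of_normBound_zeroLinear H hb hH hC hC₂ hεC.le (by linarith) hCself' hCcontr', fun B hB => ?_⟩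
  rw [mem_ball_zero_iff] at hB
  have h1 := hH₁ B
  have h2 : b₁ * ‖B‖ ≤ b₁ * Rb := mul_le_mul_of_nonneg_left hB.le hb₁
  linarith

end Room

/-! ## §5 (v2.2, gen 82, APPEND-ONLY) The same with a CAP on the Sect. C ball -/

section RoomCap

/-- **THE RADII WITH ROOM UNDER A CAP `δ` ON THE SECT. C BALL** (`ε_C + a_C ≤ δ`, hence `ε₄ + a ≤ a_C ≤ δ`): the scalar letters of §4 chosen inside a
prescribed radius — for instance the radius on which a background modulus of the letter `C` is available (`B11Eq44COperatorModulus`).  PURE ARITHMETIC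
(the Sect. C radii from `exists_regime_scalars` at `(b, 3C₂, c₄∕3)` with cap `δ`, the Sect. E/G radii at `(B₀, 3C₄, a₃∕3)` with cap `a_C`).
[cite: Balaban1985Variational, Prop. 6 (117)–(121) p.295, (62) p.287, Prop. 3 p.289, (172) p.305] -/
theorem exists_twoRegimes_radii_of_bounds_room_cap {B₀ b b₁ C₄ a₃ C₂ c₄ δ : ℝ} (hB₀ : 0 ≤ B₀) (hb : 0 ≤ b) (hb₁ : 0 ≤ b₁) (hC₄ : 0 ≤ C₄)
    (ha₃ : 0 < a₃) (hC₂ : 0 ≤ C₂) (hc₄ : 0 < c₄) (hδ : 0 < δ) :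
    ∃ j a ε₄ aC εC Rb : ℝ, 0 < j ∧ 0 < a ∧ 0 < ε₄ ∧ 0 < aC ∧ 0 < εC ∧ 0 < Rb ∧ ε₄ + a ≤ aC ∧ εC + aC ≤ δ ∧
      (6 * (ε₄ + a) ≤ a₃ ∧ 12 * B₀ * C₄ * (ε₄ + a) < 1 ∧ 6 * (εC + aC) ≤ c₄ ∧ 12 * b * C₂ * (εC + aC) < 1) ∧
      ∀ {𝒴 : Type*} [NormedAddCommGroup 𝒴] [NormedSpace ℂ 𝒴] {𝒵 : Type*} [NormedAddCommGroup 𝒵] [NormedSpace ℂ 𝒵]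
        {𝒳 : Type*} [NormedAddCommGroup 𝒳] [NormedSpace ℂ 𝒳] {ℬ : Type*} [NormedAddCommGroup ℬ] [NormedSpace ℂ ℬ]
        (𝒢 : 𝒵 →L[ℂ] 𝒴) (W : 𝒴 → 𝒵) (H : 𝒳 →L[ℂ] 𝒴) (C : 𝒴 → 𝒳) (H₁ : ℬ →L[ℂ] 𝒴),
        (∀ f, ‖𝒢 f‖ ≤ B₀ * ‖f‖) → QuadAnalytic W C₄ a₃ → (∀ Y, ‖H Y‖ ≤ b * ‖Y‖) → QuadAnalytic C C₂ c₄ →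
        (∀ B, ‖H₁ B‖ ≤ b₁ * ‖B‖) →
        Regime 𝒢 0 W B₀ 0 C₄ a₃ j a ε₄ ∧ Regime H 0 C b 0 C₂ c₄ 0 aC εC ∧ ∀ B ∈ ball (0 : ℬ) Rb, ‖H₁ B‖ < a := by
  have hC₄3 : 0 ≤ 3 * C₄ := by positivity
  have hC₂3 : 0 ≤ 3 * C₂ := by positivity
  -- Sect. C radii under the cap `δ`, then Sect. E/G radii under the cap `a_C`
  obtain ⟨j₁, aC, εC, hj₁, haC, hεC, hcapC, hCdom, hCself, hCcontr⟩ := exists_regime_scalars hb hC₂3 (by positivity : 0 < c₄ / 3) hδ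
  obtain ⟨j, a, ε₄, hj, ha, hε₄, hcap, hdom, hself, hcontr⟩ := exists_regime_scalars hB₀ hC₄3 (by positivity : 0 < a₃ / 3) haC
  have hm : 0 ≤ ε₄ + a := by linarith
  have hmC : 0 ≤ εC + aC := by linarith
  have hself' : B₀ * j + B₀ * C₄ * (ε₄ + a) ^ 2 ≤ ε₄ := by nlinarith [mul_nonneg hB₀ hC₄, sq_nonneg (ε₄ + a)]
  have hcontr' : 4 * B₀ * C₄ * (ε₄ + a) < 1 := by nlinarith [mul_nonneg (mul_nonneg hB₀ hC₄) hm]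
  have hCself' : b * 0 + b * C₂ * (εC + aC) ^ 2 ≤ εC := by
    have h0 : 0 ≤ b * j₁ := mul_nonneg hb hj₁.le
    nlinarith [mul_nonneg hb hC₂, sq_nonneg (εC + aC)]
  have hCcontr' : 4 * b * C₂ * (εC + aC) < 1 := by nlinarith [mul_nonneg (mul_nonneg hb hC₂) hmC]
  refine ⟨j, a, ε₄, aC, εC, a / (b₁ + 1), hj, ha, hε₄, haC, hεC, by positivity, hcap, hcapC,
    ⟨by linarith, by linarith, by linarith, by linarith⟩, ?_⟩
  intro 𝒴 _ _ 𝒵 _ _ 𝒳 _ _ ℬ _ _ 𝒢 W H C H₁ h𝒢 hW hH hC hH₁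
  refine ⟨Regime.of_normBound_zeroLinear 𝒢 hB₀ h𝒢 hW hC₄ hε₄.le (by linarith) hself' hcontr',
    Regime.of_normBound_zeroLinear H hb hH hC hC₂ hεC.le (by linarith) hCself' hCcontr', fun B hB => ?_⟩
  rw [mem_ball_zero_iff] at hB
  have h1 := hH₁ B
  have h2 : b₁ * ‖B‖ < a := by
    have : b₁ * ‖B‖ ≤ b₁ * (a / (b₁ + 1)) := mul_le_mul_of_nonneg_left hB.le hb₁
    refine this.trans_lt ?_
    rw [mul_div_assoc', div_lt_iff₀ (by positivity)]
    nlinarith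
  linarith

end RoomCap

end Literature.MathematicalPhysics.QuantumFieldTheory.Balaban1983to89.B11Eq118RegimeScalars

end
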